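import Literature.AlgebraicGeometry.HodgeTheory.AbelianVarietyEndomorphismsHOne
import Literature.AlgebraicGeometry.HodgeTheory.WeilClassesHodgeType
import HarnessLib

/-!
# The Weil plane of an abelian variety read on an isomorphic scheme with a compatible endomorphism

Family `hodge`, layer `Literature/AlgebraicGeometry/HodgeTheory`. Companion of `WeilClasses`
(`E± = weilClassesPlus/Minus A φ n d`, `weilClassesOf = E₊ ⊔ E₋ ⊆ H²ⁿ(A(ℂ); ℂ)`) and
`AbelianVarietyEndomorphismsHOne` (`H¹ = V₊ ⊕ V₋`, `dim E± = 1`). A fibre `Y = 𝒳_s` of a family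
of abelian varieties is only a SCHEME isomorphic to (the scheme of) an abelian variety,
`e : A.X ≅ Y`, and the `√-d` of the family restricts to an endomorphism `g_Y : Y ⟶ Y` of that
scheme, compatible with `φ ∈ End A` through `e` (`e.hom ≫ g_Y = φ ≫ e.hom`). On `Y` the Weil plane
has the purely cohomological description
`W(Y, g_Y) = Span{v₁ ⌣ ⋯ ⌣ v₂ₙ | g_Y^* vᵢ = i√d · vᵢ} ⊔ Span{v₁ ⌣ ⋯ ⌣ v₂ₙ | g_Y^* vᵢ = -i√d · vᵢ}`
(no group law on `Y` is needed), and this file proves that `e^*` identifies it with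
`weilClassesOf A φ n d`:

* `cupPowOne_mem_weilClassesPlus/Minus` — a `2n`-fold cup product of `±i√d`-eigenvectors of `φ^*`
  on `H¹(A)` lies in `E±` (the test endomorphisms `(x·𝟙 + y·φ)^*` are multiplicative and act by
  `x ± y i√d` on each factor; [vanGeemen1994HodgeAV, proof of Lemma 5.2 (6)]);
* `map_mem_weilClassesOf_of_mem_eigenLines` — `e^* W(Y, g_Y) ≤ weilClassesOf A φ n d`;
* `map_inv_mem_eigenLines_of_mem_weilClassesOf` — `(e⁻¹)^* weilClassesOf A φ n d ≤ W(Y, g_Y)` for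
  `dim A = 2n`, `φ ≫ φ = -d`, `n, d ≥ 1` (`E± = ℂ · (u₁ ⌣ ⋯ ⌣ u₂ₙ)` for an eigenbasis `u`,
  `weilClassesPlus_le_span_singleton`, `cupPowOne_ne_zero_of_linearIndependent`).

These are the fibrewise inputs of "the Weil planes form a sub-local system of `R²ⁿ f_* ℂ`"
([Deligne1982HodgeCycles, proof of Thm. 4.8, p. 50]) on the tree's carriers
(`DirectImageEndomorphism`, `WeilFamilyGlobalAction`). No definition, no named fact.

## References

* [vanGeemen1994HodgeAV] B. van Geemen, An introduction to the Hodge conjecture for abelian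
  varieties, LNM 1594 (1994), 4.9 and proof of Lemma 5.2 (6), proof of Thm. 6.12.
* [Deligne1982HodgeCycles] P. Deligne (notes by J. S. Milne), Hodge cycles on abelian varieties,
  LNM 900 (1982), §4 (4.3)–(4.4) and proof of Thm. 4.8.
-/

noncomputable section

open CategoryTheory
open Literature.AlgebraicTopology.SingularHomology

namespace Literature.AlgebraicGeometry.HodgeTheory

section HodgeTheory

variable {A : Motives.AbelianVariety ℂ}

/-! ### Cup products of eigenvectors lie in the Weil lines -/

/-- **`u₁ ⌣ ⋯ ⌣ u₂ₙ ∈ E₊` for `i√d`-eigenvectors `uᵢ` of `φ^*` on `H¹(A(ℂ); ℂ)`**: the test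
endomorphism `(x·𝟙 + y·φ)^*` is multiplicative (`map_cupPowOne`) and acts by `x + y i√d` on each
factor (`complexBetti_map_nsmul_id_add_nsmul_one_of_mem_eigenspace`).
[cite: vanGeemen1994HodgeAV, proof of Lemma 5.2 (6)] -/
theorem cupPowOne_mem_weilClassesPlus {φ : A ⟶ A} {n d : ℕ} {w : Fin (2 * n) → complexBetti A.X 1}
    (hw : ∀ i, w i ∈ Module.End.eigenspace (complexBetti.map φ.hom.hom.hom 1).hom
      (Complex.I * (Real.sqrt d : ℂ))) :
    cupPowOne ℂ (Motives.ComplexPoints A.X) (2 * n) w ∈ weilClassesPlus A φ n d := by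
  rw [mem_weilClassesPlus_iff]
  intro x y
  rw [map_cupPowOne]
  have hfac : (fun i ↦ singularCohomology.map ℂ ℂ
      (Motives.AlgPoints.mapContinuous (L := ℂ) (x • 𝟙 A + y • φ).hom.hom.hom) 1 (w i)) =
      fun i ↦ ((x : ℂ) + (y : ℂ) * (Complex.I * (Real.sqrt d : ℂ))) • w i := by
    funext i
    exact complexBetti_map_nsmul_id_add_nsmul_one_of_mem_eigenspace (hw i) x y
  rw [hfac, MultilinearMap.map_smul_univ, Finset.prod_const, Finset.card_univ, Fintype.card_fin,
    ← mul_assoc]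

/-- **`v₁ ⌣ ⋯ ⌣ v₂ₙ ∈ E₋` for `-i√d`-eigenvectors `vᵢ` of `φ^*` on `H¹(A(ℂ); ℂ)`.**
[cite: vanGeemen1994HodgeAV, proof of Lemma 5.2 (6)] -/
theorem cupPowOne_mem_weilClassesMinus {φ : A ⟶ A} {n d : ℕ} {w : Fin (2 * n) → complexBetti A.X 1}
    (hw : ∀ i, w i ∈ Module.End.eigenspace (complexBetti.map φ.hom.hom.hom 1).hom
      (-(Complex.I * (Real.sqrt d : ℂ)))) :
    cupPowOne ℂ (Motives.ComplexPoints A.X) (2 * n) w ∈ weilClassesMinus A φ n d := by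
  rw [mem_weilClassesMinus_iff]
  intro x y
  rw [map_cupPowOne]
  have hfac : (fun i ↦ singularCohomology.map ℂ ℂ
      (Motives.AlgPoints.mapContinuous (L := ℂ) (x • 𝟙 A + y • φ).hom.hom.hom) 1 (w i)) =
      fun i ↦ ((x : ℂ) + (y : ℂ) * (-(Complex.I * (Real.sqrt d : ℂ)))) • w i := by
    funext i
    exact complexBetti_map_nsmul_id_add_nsmul_one_of_mem_eigenspace (hw i) x y
  rw [hfac, MultilinearMap.map_smul_univ, Finset.prod_const, Finset.card_univ, Fintype.card_fin,
    mul_neg, ← sub_eq_add_neg, ← mul_assoc]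

/-! ### Eigenvectors through a compatible chart -/

section Chart

variable {Y : Motives.SchemeOver ℂ} {φ : A ⟶ A} (e : A.X ≅ Y) (gY : Y ⟶ Y)

/-- If `e.hom ≫ g_Y = φ ≫ e.hom` then `e^*` carries `μ`-eigenvectors of `g_Y^*` to `μ`-eigenvectors
of `φ^*` (`φ^* e^* = e^* g_Y^*`). [folklore] -/
theorem map_hom_mem_eigenspace_of_comm (he : e.hom ≫ gY = φ.hom.hom.hom ≫ e.hom) {k : ℕ} {μ : ℂ}
    {v : complexBetti Y k} (hv : v ∈ Module.End.eigenspace (complexBetti.map gY k).hom μ) :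
    complexBetti.map e.hom k v ∈ Module.End.eigenspace (complexBetti.map φ.hom.hom.hom k).hom μ := by
  rw [Module.End.mem_eigenspace_iff] at hv ⊢
  change complexBetti.map φ.hom.hom.hom k (complexBetti.map e.hom k v) = _
  rw [← ModuleCat.comp_apply, ← complexBetti.map_comp, ← he, complexBetti.map_comp,
    ModuleCat.comp_apply]
  change complexBetti.map e.hom k ((complexBetti.map gY k).hom v) = _
  rw [hv, map_smul]

/-- If `e.hom ≫ g_Y = φ ≫ e.hom` then `(e⁻¹)^*` carries `μ`-eigenvectors of `φ^*` to
`μ`-eigenvectors of `g_Y^*` (`g_Y ≫ e⁻¹ = e⁻¹ ≫ φ`). [folklore] -/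
theorem map_inv_mem_eigenspace_of_comm (he : e.hom ≫ gY = φ.hom.hom.hom ≫ e.hom) {k : ℕ} {μ : ℂ}
    {v : complexBetti A.X k} (hv : v ∈ Module.End.eigenspace (complexBetti.map φ.hom.hom.hom k).hom μ) :
    complexBetti.map e.inv k v ∈ Module.End.eigenspace (complexBetti.map gY k).hom μ := by
  have he' : gY ≫ e.inv = e.inv ≫ φ.hom.hom.hom := by
    rw [← cancel_epi e.hom, ← Category.assoc, he, Category.assoc, e.hom_inv_id, Category.comp_id,
      e.hom_inv_id_assoc]
  rw [Module.End.mem_eigenspace_iff] at hv ⊢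
  change complexBetti.map gY k (complexBetti.map e.inv k v) = _
  rw [← ModuleCat.comp_apply, ← complexBetti.map_comp, he', complexBetti.map_comp,
    ModuleCat.comp_apply]
  change complexBetti.map e.inv k ((complexBetti.map φ.hom.hom.hom k).hom v) = _
  rw [hv, map_smul]

/-- **`e^* W(Y, g_Y) ≤ weilClassesOf A φ n d`**: the chart carries the cohomological Weil plane of
`(Y, g_Y)` — the sum of the spans of the `2n`-fold cup products of `±i√d`-eigenvectors of `g_Y^*`
on `H¹(Y(ℂ); ℂ)` — into the Weil plane of `(A, φ)` (`e^*` is multiplicative, `map_cupPowOne`).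
[cite: Deligne1982HodgeCycles, §4 (4.3)–(4.4)] [cite: vanGeemen1994HodgeAV, 4.9] -/
theorem map_mem_weilClassesOf_of_mem_eigenLines {n d : ℕ}
    (he : e.hom ≫ gY = φ.hom.hom.hom ≫ e.hom) {x : complexBetti Y (2 * n)}
    (hx : x ∈ Submodule.span ℂ
        {x | ∃ w : Fin (2 * n) → complexBetti Y 1,
          (∀ i, w i ∈ Module.End.eigenspace (complexBetti.map gY 1).hom
            (Complex.I * (Real.sqrt d : ℂ))) ∧
          cupPowOne ℂ (Motives.ComplexPoints Y) (2 * n) w = x} ⊔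
      Submodule.span ℂ
        {x | ∃ w : Fin (2 * n) → complexBetti Y 1,
          (∀ i, w i ∈ Module.End.eigenspace (complexBetti.map gY 1).hom
            (-(Complex.I * (Real.sqrt d : ℂ)))) ∧
          cupPowOne ℂ (Motives.ComplexPoints Y) (2 * n) w = x}) :
    complexBetti.map e.hom (2 * n) x ∈ weilClassesOf A φ n d := by
  obtain ⟨a, ha, b, hb, rfl⟩ := Submodule.mem_sup.1 hx
  rw [map_add]
  refine Submodule.add_mem_sup ?_ ?_
  · have hle : Submodule.span ℂ
        {x | ∃ w : Fin (2 * n) → complexBetti Y 1,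
          (∀ i, w i ∈ Module.End.eigenspace (complexBetti.map gY 1).hom
            (Complex.I * (Real.sqrt d : ℂ))) ∧
          cupPowOne ℂ (Motives.ComplexPoints Y) (2 * n) w = x} ≤
        (weilClassesPlus A φ n d).comap (complexBetti.map e.hom (2 * n)).hom := by
      refine Submodule.span_le.2 ?_
      rintro _ ⟨w, hw, rfl⟩
      change complexBetti.map e.hom (2 * n) (cupPowOne ℂ (Motives.ComplexPoints Y) (2 * n) w) ∈
        weilClassesPlus A φ n d
      rw [complexBetti.map, map_cupPowOne]
      exact cupPowOne_mem_weilClassesPlus fun i ↦ map_hom_mem_eigenspace_of_comm e gY he (hw i)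
    exact hle ha
  · have hle : Submodule.span ℂ
        {x | ∃ w : Fin (2 * n) → complexBetti Y 1,
          (∀ i, w i ∈ Module.End.eigenspace (complexBetti.map gY 1).hom
            (-(Complex.I * (Real.sqrt d : ℂ)))) ∧
          cupPowOne ℂ (Motives.ComplexPoints Y) (2 * n) w = x} ≤
        (weilClassesMinus A φ n d).comap (complexBetti.map e.hom (2 * n)).hom := by
      refine Submodule.span_le.2 ?_
      rintro _ ⟨w, hw, rfl⟩
      change complexBetti.map e.hom (2 * n) (cupPowOne ℂ (Motives.ComplexPoints Y) (2 * n) w) ∈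
        weilClassesMinus A φ n d
      rw [complexBetti.map, map_cupPowOne]
      exact cupPowOne_mem_weilClassesMinus fun i ↦ map_hom_mem_eigenspace_of_comm e gY he (hw i)
    exact hle hb

/-- **A Weil line is spanned by the cup product of an eigenbasis, read on `Y`**: for `dim A = 2n`,
`φ ≫ φ = -d`, `d ≥ 1`, `μ = ±i√d`, every class of the joint eigen-line of character `(x + yμ)²ⁿ`
is `a · (u₁ ⌣ ⋯ ⌣ u₂ₙ)` for an eigenbasis `u` of `V_μ` (`dim V_μ = 2n`,
`weilClassesPlus/Minus_le_span_singleton`, `cupPowOne_ne_zero_of_linearIndependent`), hence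
`(e⁻¹)^*` of it lies in the span of the `2n`-fold cup products of `μ`-eigenvectors of `g_Y^*`.
[cite: vanGeemen1994HodgeAV, proof of Thm. 6.12] -/
theorem map_inv_mem_span_cupPowOne_of_mem_weilLine {n d : ℕ} (hd : 0 < d) (hA : A.dim = 2 * n)
    (hφ : φ ≫ φ = -(d • 𝟙 A)) (he : e.hom ≫ gY = φ.hom.hom.hom ≫ e.hom) {μ : ℂ}
    (hμ : μ = Complex.I * (Real.sqrt d : ℂ) ∨ μ = -(Complex.I * (Real.sqrt d : ℂ)))
    {c : complexBetti A.X (2 * n)}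
    (hc : ∀ c' : complexBetti A.X (2 * n), c' ≠ 0 →
      (∃ w : Fin (2 * n) → complexBetti A.X 1,
        (∀ i, w i ∈ Module.End.eigenspace (complexBetti.map φ.hom.hom.hom 1).hom μ) ∧
        cupPowOne ℂ (Motives.ComplexPoints A.X) (2 * n) w = c') → c ∈ ℂ ∙ c') :
    complexBetti.map e.inv (2 * n) c ∈ Submodule.span ℂ
        {x | ∃ w : Fin (2 * n) → complexBetti Y 1,
          (∀ i, w i ∈ Module.End.eigenspace (complexBetti.map gY 1).hom μ) ∧
          cupPowOne ℂ (Motives.ComplexPoints Y) (2 * n) w = x} := by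
  classical
  haveI := finite_complexBetti_abelianVariety A 1
  set T := (complexBetti.map φ.hom.hom.hom 1).hom with hT
  -- `dim V_μ = 2n`
  have hb₁ : Module.finrank ℂ (complexBetti A.X 1) = 2 * (2 * n) := by
    rw [Motives.AbelianVariety.finrank_complexBetti_one, hA]
  have hps : Module.finrank ℂ (Module.End.eigenspace T (Complex.I * (Real.sqrt d : ℂ))) = 2 * n := by
    have h := two_mul_finrank_eigenspace_eq hd hφ
    rw [hb₁] at h
    change 2 * Module.finrank ℂ (Module.End.eigenspace T (Complex.I * (Real.sqrt d : ℂ))) =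
      2 * (2 * n) at h
    omega
  have hp : Module.finrank ℂ (Module.End.eigenspace T μ) = 2 * n := by
    rcases hμ with rfl | rfl
    · exact hps
    · have h := finrank_eigenspace_eq_finrank_eigenspace_neg hd hφ
      change Module.finrank ℂ (Module.End.eigenspace T (Complex.I * (Real.sqrt d : ℂ))) =
        Module.finrank ℂ (Module.End.eigenspace T (-(Complex.I * (Real.sqrt d : ℂ)))) at h
      rw [← h, hps]
  -- an eigenbasis `u` of `V_μ` and the generator `ω = u₁ ⌣ ⋯ ⌣ u₂ₙ`
  let bV := Module.finBasisOfFinrankEq ℂ (Module.End.eigenspace T μ) hp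
  let u : Fin (2 * n) → complexBetti A.X 1 := fun i ↦ (bV i : complexBetti A.X 1)
  have hu_mem : ∀ i, u i ∈ Module.End.eigenspace T μ := fun i ↦ (bV i).2
  have hli : LinearIndependent ℂ u :=
    bV.linearIndependent.map' (Module.End.eigenspace T μ).subtype (Submodule.ker_subtype _)
  set ω := cupPowOne ℂ (Motives.ComplexPoints A.X) (2 * n) u with hω
  have hω0 : ω ≠ 0 := cupPowOne_ne_zero_of_linearIndependent A hli
  -- `c = a • ω`
  obtain ⟨a, rfl⟩ := Submodule.mem_span_singleton.1 (hc ω hω0 ⟨u, hu_mem, rfl⟩)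
  rw [map_smul]
  refine Submodule.smul_mem _ a (Submodule.subset_span ⟨fun i ↦ complexBetti.map e.inv 1 (u i),
    fun i ↦ map_inv_mem_eigenspace_of_comm e gY he (hu_mem i), ?_⟩)
  rw [hω, complexBetti.map, map_cupPowOne]

/-- **`(e⁻¹)^* weilClassesOf A φ n d ≤ W(Y, g_Y)`** for `dim A = 2n`, `φ ≫ φ = -d`, `n, d ≥ 1`: the
inverse chart carries the Weil plane `E₊ ⊔ E₋` of `(A, φ)` into the cohomological Weil plane of
`(Y, g_Y)` (each Weil line is `ℂ · (u₁ ⌣ ⋯ ⌣ u₂ₙ)` for an eigenbasis, `weilClassesPlus/Minus_le_span_singleton`).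
[cite: vanGeemen1994HodgeAV, 4.9 and proof of Thm. 6.12] [cite: Deligne1982HodgeCycles, §4 (4.3)–(4.4)] -/
theorem map_inv_mem_eigenLines_of_mem_weilClassesOf {n d : ℕ} (hd : 0 < d) (hA : A.dim = 2 * n)
    (hφ : φ ≫ φ = -(d • 𝟙 A)) (he : e.hom ≫ gY = φ.hom.hom.hom ≫ e.hom)
    {c : complexBetti A.X (2 * n)} (hc : c ∈ weilClassesOf A φ n d) :
    complexBetti.map e.inv (2 * n) c ∈ Submodule.span ℂ
        {x | ∃ w : Fin (2 * n) → complexBetti Y 1,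
          (∀ i, w i ∈ Module.End.eigenspace (complexBetti.map gY 1).hom
            (Complex.I * (Real.sqrt d : ℂ))) ∧
          cupPowOne ℂ (Motives.ComplexPoints Y) (2 * n) w = x} ⊔
      Submodule.span ℂ
        {x | ∃ w : Fin (2 * n) → complexBetti Y 1,
          (∀ i, w i ∈ Module.End.eigenspace (complexBetti.map gY 1).hom
            (-(Complex.I * (Real.sqrt d : ℂ)))) ∧
          cupPowOne ℂ (Motives.ComplexPoints Y) (2 * n) w = x} := by
  have hΛ := Motives.AbelianVariety.hasExteriorCohomologyH1_complexPoints A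
  have hb₁ : Module.finrank ℂ (complexBetti A.X 1) = 2 * (2 * n) := by
    rw [Motives.AbelianVariety.finrank_complexBetti_one, hA]
  obtain ⟨c₁, h₁, c₂, h₂, rfl⟩ := Submodule.mem_sup.1 hc
  rw [map_add]
  refine Submodule.add_mem_sup ?_ ?_
  · refine map_inv_mem_span_cupPowOne_of_mem_weilLine e gY hd hA hφ he (Or.inl rfl) ?_
    intro c' hc'0 ⟨w, hw, hwc'⟩
    have hc'E : c' ∈ weilClassesPlus A φ n d := hwc' ▸ cupPowOne_mem_weilClassesPlus hw
    exact weilClassesPlus_le_span_singleton hΛ hb₁ hd hφ hc'E hc'0 h₁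
  · refine map_inv_mem_span_cupPowOne_of_mem_weilLine e gY hd hA hφ he (Or.inr rfl) ?_
    intro c' hc'0 ⟨w, hw, hwc'⟩
    have hc'E : c' ∈ weilClassesMinus A φ n d := hwc' ▸ cupPowOne_mem_weilClassesMinus hw
    exact weilClassesMinus_le_span_singleton hΛ hb₁ hd hφ hc'E hc'0 h₂

end Chart

end HodgeTheory

end Literature.AlgebraicGeometry.HodgeTheory

end
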